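import Summits.CriticalPhenomena.PercolationContinuityZ3.Theorems.Transplant.KNCells2ZdGeom
import Summits.CriticalPhenomena.PercolationContinuityZ3.Theorems.Transplant.KNLevelsZdBridge
import Summits.CriticalPhenomena.PercolationContinuityZ3.Theorems.Transplant.KNLevelsTargetPropertyKN
import Literature.Probability.Percolation.KozmaNitzanTheorem6
import HarnessLib

/-!
# ℤ^d REGRESSION of the lag-1 node theorem, part 2 — the three PROBABILISTIC inputs of `KNCells.KSchA.samePWitnessAt_of_kit₂'` on `ℤ^d`
# from Kozma–Nitzan's own (32)/(33)/Step IV, and the assembly: `SameP.SamePWitnessAt (zdGraph d) 0 p` THROUGH THE GENERIC LAYER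

builds on p205010 (kernel theorem, internal audit signed; external expert review pending) — nothing in this file uses p205010.
Lane `prim-bschramm`, seat `prim-bschramm-stmt` (gen 3); helper file (`--supports stmt-CriticalPhenomena-4575`).

The single target for the instances (p2-g2's `samePWitnessAt_of_kit₂'`, lag-1 anchors) at the model instance `S := KSchA.ofKSch S₀`
(`A = Unit`, KN's cells; geometry discharged in `KNCells2ZdGeom`):
* `valid_of_valid₂` — a `Valid₂` history of the anchored scheme is a `Valid` history of KN's scheme (the anchored notions collapse: `ofKSch_W₀`,
  `ofKSch_Wfull`, `ofKSch_Reach`, `ofKSch_Cover`, `lattW_eq`);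
* hence `hface` is KN's `KSch.cond_of_face` ((33), the target lemma at the faces), `hreach` is KN's `KSch.reach_bound` (Step IV from (32) by
  Lemma 12), `hQ0` is KN's `KSch.hQ0_of_hit` ((32) at the origin);
* **`samePWitnessAt_zd_of_target`** — for `d ≥ 3`, `0 < p < 1`, `θ(p) > 0` and KN's `TargetProperty d p` (Lemma 10 as a property; = Conjecture
  3's consequence), the generic node theorem yields `SameP.SamePWitnessAt (zdGraph d) 0 p`, with the constants chosen exactly as in
  `KSch.exists_KSch_theta_slab_pos_of_target` (`ε = 2⁻³³`; `δ, m` from Lemma 12 at `ε/8`; `δc = min δ ½`; `δ₂` from Lemma 10 at `δc`; `K ≥ 20`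
  with `(1-δ₂)^K ≤ ε/8`; `R`; `s ≥ 2R, m`, hittability thresholds; `r = Ks`);
* **`samePWitnessAt_zd_of_levels`** — the same from the LEVELS form `KNLevels.TargetProperty (zdGraph d) (2d) p` (stmt's `KNLevelsZdBridge`), and
  **`samePWitnessAt_zd`** — unconditionally (`KNLevels.targetProperty_zdGraph_KN`, i.e. Kozma–Nitzan Conjecture 3 as the tree theorem
  `CSH.kozmaNitzan_conjecture3_holds` behind `targetLemma_of_kits_KN`).
So every hypothesis of the single target is JOINTLY SATISFIABLE on the model case and the generic layer reproduces the ℤ^d witness (p4's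
`SameP` files prove the same conclusion through KN's original `KSch`; this file goes through `KNCells2*`).  REGRESSION ONLY — no new case of
Conjecture 4.

[cite: KozmaNitzan2024, §4 Theorem 6 (pp. 25–31), (32), (33), Step IV — the ℤ^d model] [cite: GrimmettPercolation1999, §7.2]
-/

noncomputable section

open MeasureTheory ProbabilityTheory
open scoped ENNReal Classical

namespace Summit.CriticalPhenomena.PercolationContinuityZ3.Theorems

namespace Transplant

namespace KNCells

open Literature.Probability.Percolation Literature.Probability.LatticeModels SimpleGraph GadgetSystem ProbeHistory HSiteScheme Contour
open Literature.Probability.Percolation.KozmaNitzan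
open Literature.Probability.Percolation.KozmaNitzan.Cells (sgOf sgOf_sign)

variable {d : ℕ}

namespace ZdReg

/-! ## §1 The anchored notions collapse to KN's -/

/-- The generic graph weighting on `ℤ^d` is KN's lattice weighting. [folklore] -/
theorem lattW_eq (p : unitInterval) : KNLevels.lattW (zdGraph d) p = KozmaNitzan.lattW d p := by
  funext x
  rw [KNLevels.lattW_apply, KozmaNitzan.lattW_apply]

/-- The weighting of (32) of the instance is KN's `W₀`. [cite: KozmaNitzan2024, §4 p. 28 ((32))] -/
theorem ofKSch_W₀ (S : KSch d) (h : ProbeHistory (Site d)) (e : Site 2 × MDir) (a : Unit) :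
    (KSchA.ofKSch S).W₀ (zdGraph d) h e a = S.W₀ h e := by
  unfold KSchA.W₀ KSch.W₀
  rw [lattW_eq]
  rfl

/-- The Step-IV weighting of the instance is KN's `Wfull`. [cite: KozmaNitzan2024, §4 p. 30 (Step IV)] -/
theorem ofKSch_Wfull (S : KSch d) (h : ProbeHistory (Site d)) (e : Site 2 × MDir) (a a' : Unit) (du : MDir) :
    (KSchA.ofKSch S).Wfull (zdGraph d) h e a a' du = S.Wfull h e du := by
  unfold KSchA.Wfull KSch.Wfull
  rw [lattW_eq]
  rfl

/-- The Step-IV target event of the instance (faces/corridors `faceDataOfCells`) is KN's `Reach`. [cite: KozmaNitzan2024, §4 p. 30 (Step IV)] -/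
theorem ofKSch_Reach (S : KSch d) (h : ProbeHistory (Site d)) (e : Site 2 × MDir) (a a' : Unit) (du : MDir) :
    (KSchA.ofKSch S).Reach (zdGraph d) (faceDataOfCells S.C) h e a a' du = S.Reach h e du := rfl

/-- The cover of the instance is KN's cover. [cite: KozmaNitzan2024, §4 p. 26 ((29))] -/
theorem ofKSch_Cover (S : KSch d) (arr dep : Site 2 → Unit) (det : Set (Site 2)) :
    (KSchA.ofKSch S).Γ.Cover arr dep det = S.C.Cover det := rfl

/-- **A `Valid₂` history of the anchored scheme on `ℤ^d` is a `Valid` history of KN's scheme.** [cite: KozmaNitzan2024, §4 pp. 26–28 ((29), (31), (32))] -/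
theorem valid_of_valid₂ (S : KSch d) {h : ProbeHistory (Site d)} {e : Site 2 × MDir} (hV : (KSchA.ofKSch S).Valid₂ (zdGraph d) h e) :
    S.Valid h e where
  F_eq := hV.F_eq
  ξ_sub := hV.ξ_sub
  zero_mem := hV.root_mem
  src_mem := by
    obtain ⟨y, hy, hyc⟩ := hV.src_mem
    have hy' : y = S.C.cen e.1 := Set.mem_singleton_iff.1 hyc
    subst hy'
    exact hy
  cover := by
    obtain ⟨det, h1, h2, h3⟩ := hV.cover
    refine ⟨det, h1, fun du hdu => h2 du ?_, h3⟩
    rw [KSchA.ofKSch_onward]; exact hdu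
  reach := by
    have h := hV.reach
    rw [ofKSch_W₀] at h
    exact h

/-! ## §2 The assembly through the generic node theorem -/

/-- **ℤ^d regression of the lag-1 node theorem**: for `d ≥ 3`, `0 < p < 1`, `θ_{ℤ^d}(p) > 0` and KN's Lemma 10 as a property
(`KozmaNitzan.TargetProperty d p`), the GENERIC `samePWitnessAt_of_kit₂'` at KN's own cells gives `SameP.SamePWitnessAt (zdGraph d) 0 p`; the
constants are those of `KSch.exists_KSch_theta_slab_pos_of_target` (with `ε = 2⁻³³`). [cite: KozmaNitzan2024, §4 Theorem 6 (pp. 25–31)] -/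
theorem samePWitnessAt_zd_of_target [NeZero d] (hd : 3 ≤ d) (p : unitInterval) (hT : KozmaNitzan.TargetProperty d p)
    (hp1 : (p : ℝ) < 1) (hθ : 0 < theta (zdGraph d) (0 : Site d) p) :
    SameP.SamePWitnessAt (zdGraph d) (0 : Site d) p := by
  -- `ε`
  set ε : ℝ := (1 / 2) ^ 33 with hε
  have hε0 : 0 < ε := by positivity
  have hε32 : ε < (1 / 2) ^ 32 := by rw [hε]; norm_num
  -- Lemma 12 at `ε / 8`
  obtain ⟨δ, hδ0, m, hcorr⟩ := CData.corridorLemma_of_target p hT hp1 hθ (ε := ε / 8) (by positivity)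
  set δc : ℝ := min δ (1 / 2) with hδc
  have hδc0 : 0 < δc := lt_min hδ0 (by norm_num)
  have hδc1 : δc ≤ 1 := (min_le_right _ _).trans (by norm_num)
  have hδcδ : δc ≤ δ := min_le_left _ _
  -- Lemma 10 at `δc`
  obtain ⟨δ₂, hδ₂0, htgt0⟩ := hT hδc0
  set δ₂' : ℝ := min δ₂ 1 with hδ₂'
  have hδ₂'0 : 0 < δ₂' := lt_min hδ₂0 one_pos
  have hδ₂'1 : δ₂' ≤ 1 := min_le_right _ _
  have hδ₂'2 : δ₂' ≤ δ₂ := min_le_left _ _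
  -- `K`
  obtain ⟨K₀, hK₀⟩ := exists_pow_lt_of_lt_one (show 0 < ε / 8 by positivity) (show 1 - δ₂' < 1 by linarith)
  set K : ℕ := max K₀ 20 with hK
  have hK20 : 20 ≤ K := le_max_right _ _
  have hKε : 4 * ((1 - δ₂') ^ K + ε / 8) ≤ ε := by
    have : (1 - δ₂') ^ K ≤ (1 - δ₂') ^ K₀ := pow_le_pow_of_le_one (by linarith) (by linarith) (le_max_left _ _)
    linarith
  -- `R`
  have hK2 : 2 ≤ 2 * K := by omega
  obtain ⟨R, hR⟩ := htgt0 (elongList d (2 * K) (by omega)) (isHittable_of_mem_elongList_of_target p hT hp1 hθ (2 * K) hK2)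
  -- the hittability thresholds for (32) at the origin
  set C₀ : Cells d := ⟨hd, 20, 1, le_rfl, le_rfl⟩ with hC₀
  have hhit6 : ∀ du : MDir, ∃ kℓ : ℕ, ∀ m', kℓ ≤ m' → ∀ ℓ, kℓ ≤ ℓ →
      1 - δc < (bondPercolation (zdGraph d) p).real
        (linkIn (↑((elongGeom (C₀.axOf du) (σu du) 6 (by norm_num)).Qset ℓ 0)) (box d m')
          ((elongGeom (C₀.axOf du) (σu du) 6 (by norm_num)).Fset ℓ 0)) := by
    intro du
    obtain ⟨k, ℓ₀, h⟩ := (isHittable_elongGeom_of_target p hT hp1 hθ (C₀.axOf du) (σu du) 6 (by norm_num)).hit δc hδc0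
    exact ⟨max k ℓ₀, fun m' hm' ℓ hℓ => h m' ((le_max_left _ _).trans hm') ℓ ((le_max_right _ _).trans hℓ)⟩
  choose kℓ hkℓ using hhit6
  set kmax : ℕ := Finset.univ.sup kℓ with hkmax
  have hkmax' : ∀ du, kℓ du ≤ kmax := fun du => Finset.le_sup (f := kℓ) (Finset.mem_univ du)
  -- `s` and the scheme
  set s : ℕ := max (max (max 1 (2 * R)) m) kmax with hs
  have hs1 : 1 ≤ s := le_trans (le_trans (le_max_left _ _) (le_max_left _ _)) (le_max_left _ _)
  have hsR : 2 * R ≤ s := le_trans (le_trans (le_max_right _ _) (le_max_left _ _)) (le_max_left _ _)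
  have hsm : m ≤ s := le_trans (le_max_right _ _) (le_max_left _ _)
  have hsk : kmax ≤ s := le_max_right _ _
  set C : Cells d := ⟨hd, K, s, hK20, hs1⟩ with hCdef
  set S : KSch d := ⟨C, p, δc⟩ with hSdef
  have hsr : s ≤ C.r := by
    show s ≤ K * s
    exact Nat.le_mul_of_pos_left s (by omega)
  -- KN's two probabilistic inputs, in KN's vocabulary
  have hcorr' : ∀ T : CData d, T.Hyp S.p → T.r = S.C.r →
      1 - S.δc < (prodBernoulli T.W).real
          (⋃ b ∈ Finset.Icc (T.c - ((3 * T.r : ℕ) : Site d)) (T.c + ((3 * T.r : ℕ) : Site d)),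
            openConnIn (↑T.Aset : Set (Site d)) T.o b) →
        1 - ε / 8 < (prodBernoulli T.W).real (⋃ b ∈ T.Tn (3 * T.r), openConnIn (↑T.Uset : Set (Site d)) T.o b) := by
    intro T hTh hTr hyp
    refine hcorr T hTh ?_ (lt_of_le_of_lt (by show 1 - δ ≤ 1 - S.δc; change 1 - δ ≤ 1 - δc; linarith) hyp)
    rw [hTr]; exact hsm.trans hsr
  have htgt' : ∀ (W : Sym2 (Site d) → unitInterval) (Sfin D : Finset (Site d)) (lo hi : Site d) (T : Finset (Site d)) (o : Site d),
      FinSupp W Sfin → IsSubbox W S.p D → D ⊆ Sfin → o ∈ Sfin → o ∉ D →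
      Finset.Icc (lo - (R : Site d)) (hi + (R : Site d)) ⊆ D →
      IsTarget T lo hi D R (elongList d (2 * S.C.K) (by have := S.C.hK; omega)) → T ⊆ D → T.Nonempty →
      1 - δ₂' < (prodBernoulli W).real (⋃ b ∈ Finset.Icc lo hi, openConn o b) →
      1 - S.δc < (prodBernoulli W).real (⋃ t ∈ T, openConn o t) :=
    fun W Sfin D lo hi T o h1 h2 h3 h4 h5 h6 h7 h8 h9 h10 =>
      hR W Sfin D lo hi T o h1 h2 h3 h4 h5 h6 h7 h8 h9 (lt_of_le_of_lt (by show 1 - δ₂ ≤ 1 - δ₂'; linarith) h10)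
  -- the generic node theorem at KN's own cells
  exact KSchA.samePWitnessAt_of_kit₂' (G := zdGraph d) (S := KSchA.ofKSch S) (FD := faceDataOfCells C) (LD := levelDataOfCells C)
    (runGeom_ofCells C) (anchGeom_ofCells C) (sepGeom₂_ofCells C) (exitGeom_ofCells C) (stepsGeom_ofCells C) (levelGeom_ofCells C)
    (Δ := 2 * d) (B := (70 * C.r + 1) ^ d) degree_zdGraph_le_two_mul (card_envRegion₂_ofKSch_le S) hδc1
    (ε := ε) (ε' := ε / 8) (δ₂ := δ₂') hε32 (by positivity) hδ₂'1 hKε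
    (fun du => by
      have h := S.hQ0_of_hit du (hkℓ du (3 * C.r) (by linarith [hkmax' du]) (3 * C.r) (by linarith [hkmax' du]))
      rw [lattW_eq]
      exact h)
    (fun h e hV du hdu j hj o hfc => by
      have hV' := valid_of_valid₂ S hV
      have hdu' : du ∈ S.onward h (tgt e) := by rw [← KSchA.ofKSch_onward]; exact hdu
      rw [KSchA.ofKSch_cond]
      rw [KSchA.ofKSch_Wt] at hfc
      exact KSch.cond_of_face hV' hdu' htgt' hsR hj o hfc)
    (fun h e hV du hdu => by
      have hV' := valid_of_valid₂ S hV
      have hdu' : du ∈ S.onward h (tgt e) := by rw [← KSchA.ofKSch_onward]; exact hdu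
      rw [ofKSch_Wfull, ofKSch_Reach]
      exact KSch.reach_bound hV' hdu' hcorr')

/-- **The same from the LEVELS form of Lemma 10** (`KNLevels.TargetProperty (zdGraph d) (2d) p`, via stmt's `KNLevelsZdBridge.targetPropertyZd_of_levels`).
[cite: KozmaNitzan2024, §4 Theorem 6 (pp. 25–31)] -/
theorem samePWitnessAt_zd_of_levels [NeZero d] (hd : 3 ≤ d) (p : unitInterval) (hp0 : 0 < (p : ℝ)) (hp1 : (p : ℝ) < 1)
    (hθ : 0 < theta (zdGraph d) (0 : Site d) p) (hT : KNLevels.TargetProperty (zdGraph d) (2 * d) p) :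
    SameP.SamePWitnessAt (zdGraph d) (0 : Site d) p :=
  samePWitnessAt_zd_of_target hd p (targetPropertyZd_of_levels p hp0 hp1 hθ hT) hp1 hθ

/-- **The ℤ^d same-`p` witness THROUGH THE GENERIC LAG-1 LAYER, unconditionally** (`d ≥ 3`, `0 < p < 1`, `θ_{ℤ^d}(p) > 0`): Lemma 10 in levels
form is the tree theorem `KNLevels.targetProperty_zdGraph_KN` (Kozma–Nitzan Conjecture 3 = `CSH.kozmaNitzan_conjecture3_holds` behind it).  Regression of
p4's `SameP` witness on `ℤ^d` (same conclusion, KN's original scheme). [cite: KozmaNitzan2024, §4 Theorem 6 (pp. 25–31)] -/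
theorem samePWitnessAt_zd [NeZero d] (hd : 3 ≤ d) (p : unitInterval) (hp0 : 0 < (p : ℝ)) (hp1 : (p : ℝ) < 1)
    (hθ : 0 < theta (zdGraph d) (0 : Site d) p) : SameP.SamePWitnessAt (zdGraph d) (0 : Site d) p :=
  samePWitnessAt_zd_of_levels hd p hp0 hp1 hθ (KNLevels.targetProperty_zdGraph_KN d p hp1)

end ZdReg

end KNCells

end Transplant

end Summit.CriticalPhenomena.PercolationContinuityZ3.Theorems

end
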